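import Literature.AnabelianGeometry.EtaleTheta.SettingModel2
import Literature.AnabelianGeometry.EtaleTheta.SettingModelThetaCentreZHat
import Literature.AnabelianGeometry.EtaleTheta.Discharge.Sec2InertiaOntoDeltaTheta
import HarnessLib

/-!
# A model of the [EtTh] §1 root WITH A COMMUTATOR-AXIS CUSP: `curve₂ᶜ` / `ThetaSetting.model₂ᶜ p` — the finer
# (untwisted) model `Γ × G_{ℚ_p}` with ONE cusp whose inertia is print's boundary-commutator axis `⁅a,b⁆^Ẑ`

S. Mochizuki, *The étale theta function and its Frobenioid-theoretic manifestations*, Publ. RIMS **45** (2009)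
[EtTh], §1, PRIMS PDF pp. 11–13 [cite: MochizukiEtTh2009, §1 p.12]: «`Δ_X` … a profinite free group on 2
generators», «any decomposition group of a cusp of `Y^log`» (p. 13); §2 p. 35 (printed 261): «Let us write `x` for
the unique cusp of `X^log`. Then there is a natural injective [outer] homomorphism `D_x → Π^Θ_X` … which maps the
inertia group `I_x ⊆ D_x` isomorphically onto `Δ_Θ`»; S. Mochizuki, *Semi-graphs of anabelioids*, Publ. RIMS
**42** (2006) [SemiAnbd], §6 p. 71: «`I_x` is isomorphic to `Ẑ(1)` if `x` is a cusp»
[cite: MochizukiSemiAnbd2006, §6 p.71].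

Cell abc-iut, layer L2 (NV lane), seat abc-iut-w5-d165 (gen 4); bears on GAP-LEDGER G-L2t10-3 / G-w4d005g4-1
(the «cusp-POSITION» interface junction, NODES IUTchII:Cor2.5(i) v3.4am) and on the v-next §1 interface clause
of record «for a topological generating pair `a, b` of `Δ_X` the inertia subgroup of the cusp is `⟨[a,b]⟩⁻`»
(GAP-LEDGER l.273). THE GAP IN THE MODEL ZOO (abc-iut-w5-d037 gen 8, D-row 09:07:43Z; abc-iut-L2-t10 gen 5
`SettingModelChiCuspInertiaNotTheta`): every `ThetaSetting` inhabitant of the tree either has NO closed point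
(`model`, `model₂`, `modelχ`, `modelχq`) or a SYNTHETIC cusp on the Tate-twisted TORAL axis `b^Ẑ` (`curveχ′`,
`curveχq′`), on which the commutator-axis clause is REFUTED; so the clause — and with it every binder of the
G-L2t10-3 family — had no model. THIS FILE supplies one, over abc-iut-L2-t1's finer model `model₂`
(`Π^tp_X := Γ × G_{ℚ_p}`, `Γ = F̂₂ ×_Ẑ ℤ`, UNTWISTED, so the commutator axis IS Galois-stable):

* §1 the **commutator axis** `c^Ẑ ⊆ F̂₂`: `cPow : Ẑ →ₜ* F̂₂` (a CHOICE of abc-iut-L6-d6's `exists_cPow`,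
  `c^{ι 1} = η⁅a,b⁆`), its level formula `hHat_cPow` (`ĥ_N(c^t) = (0,0,t mod N)`), `cPow_injective`,
  `isClosedEmbedding_cPow`, the closed subgroup `cAxis = c^Ẑ` with **`cAxis_eq_closure_zpowers`**
  (`c^Ẑ = ⟨η⁅a,b⁆⟩⁻`) and `cAxisEquiv : ↥cAxis ≃ₜ* Ẑ`;
* §2 the same inside `Γ` (`cPowGfp`, `cAxisGfp`; legitimate because `ê(c^t) = 1`), and the **cusp datum** on
  `Π^tp_X = Γ × G_{ℚ_p}`: `cuspDecomp₂ᶜ p := c^Ẑ × G_{ℚ_p}` — closed, `aug`-image all of `G_{ℚ_p}`, inertia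
  `c^Ẑ × 1 ≃ₜ* Ẑ` (`inertiaEquiv₂ᶜ`);
* §3 **`curve₂ᶜ p : TemperedCurve p`** — `curve₂ p` with `Pt := Unit`, `IsCusp := ⊤`, `decomp _ := cuspDecomp₂ᶜ p`
  (same `K`, `Π^tp`, `aug`, `Π`, `toHat`, `augHat`), and **`ThetaSetting.model₂ᶜ p : ThetaSetting p`** —
  abc-iut-L2-t1's record `model₂` VERBATIM over `curve₂ᶜ` (the carriers agree definitionally) — with
  `model₂ᶜ_isEtThOrigin`, `inertia_model₂ᶜ_eq` (`I_x = c^Ẑ × 1`) and **`map_toHat_inertia_model₂ᶜ`**: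
  `toHat(I_x) = ⟨⁅a,b⁆⟩⁻` for the generating pair `a = (η a, 1)`, `b = (η b, 1)` of `Δ_X = F̂₂ × 1` — the
  commutator-axis clause ON THE NOSE;
* §4 the NON-VACUITY theorems: **`map_toTheta_inertia_model₂ᶜ`** — at `model₂ᶜ` the cusp-position binder of
  GAP-LEDGER G-L2t10-3 / p434999 HOLDS: `toTheta(I_x) = Δ_Θ` (this seat's p435890
  `map_toTheta_inertia_eq_deltaTheta_of_commutatorAxis` applied to §3), and
  **`ThetaSetting.exists_isEtThOrigin_commutatorAxis_cusp`** — root interface + guard `IsEtThOrigin` + a cusp ON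
  THE COMMUTATOR AXIS (+ «`I_x ⥲ Δ_Θ`» onto-form) are JOINTLY SATISFIABLE: the v-next §1 clause has a model.

HONEST LABEL: SEMI-SYNTHETIC model, consistency evidence only — not the tempered `π₁` of a once-punctured elliptic
curve; the arithmetic factor acts TRIVIALLY on `Γ` (no cyclotomic character: the model serves the cusp-POSITION
clause jointly with the §1 root interface and its guard, NOT the `Compat`/Kummer-class clauses, which is what the
χ-twisted models are for). Classical profinite group theory; nothing of [EtTh]/[SemiAnbd] is asserted; no side is
taken on [IUTchIII] Cor. 3.12. Post-freeze class (b) construction (new model file, no edit of any other seat's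
file); no instance on an existing type, no `Prop` fact.
-/

noncomputable section

namespace Literature.AnabelianGeometry.EtaleTheta.SettingModel

open Literature.AnabelianGeometry.SemiGraphs
open Literature.AnabelianGeometry.AbsoluteAnabelian
open CategoryTheory Function _root_.Topology
open scoped commutatorElement

/-! ## §1. The commutator axis `c^Ẑ ⊆ F̂₂` -/

/-- The boundary commutator `c := ⁅a, b⁆ ∈ F₂` (the loop around the cusp of the once-punctured torus).
[cite: MochizukiEtTh2009, Def 2.1 p.35] -/
abbrev cElt : F₂ := ⁅FreeGroup.of (0 : Fin 2), FreeGroup.of 1⁆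

/-- **`c^· : Ẑ → F̂₂`**, a continuous homomorphism with `ι 1 ↦ η(c)` — a CHOICE of abc-iut-L6-d6's `exists_cPow`
(all such maps agree, `Ẑ` being topologically generated by `ι 1`). [cite: MochizukiEtTh2009, §1 p.12] -/
def cPow : ZH →ₜ* F₂hatT := Classical.choose exists_cPow

/-- `c^{ι 1} = η(c)`. [cite: MochizukiEtTh2009, §1 p.12] -/
theorem cPow_spec : cPow (iotaZ (Multiplicative.ofAdd 1)) = eta cElt := Classical.choose_spec exists_cPow

/-- `c^{ι k} = η(c^k)`. [cite: MochizukiEtTh2009, §1 p.12] -/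
theorem cPow_iotaZ (k : Multiplicative ℤ) : cPow (iotaZ k) = eta (cElt ^ Multiplicative.toAdd k) :=
  apply_iotaZ_of_cPowSpec cPow cPow_spec k

/-- **`ĥ_N(c^t) = (0, 0, t mod N)`** (abc-iut-L6-d6's level formula for the chosen `c^·`).
[cite: MochizukiEtTh2009, §1 p.12] -/
theorem hHat_cPow (N : ℕ+) (t : ZH) : hHat N (cPow t) = ⟨0, 0, Multiplicative.toAdd (modN N t)⟩ :=
  hHat_apply_of_cPowSpec cPow cPow_spec N t

/-- `ê(c^t) = 1`: the commutator axis has `a`-degree `0`. [cite: MochizukiEtTh2009, §1 p.12] -/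
theorem eHat_cPow (t : ZH) : eHat (cPow t) = 1 := eHat_apply_of_cPowSpec cPow cPow_spec t

/-- `c^t ∈ [F̂₂,F̂₂]⁻`. [cite: MochizukiEtTh2009, §1 p.12] -/
theorem cPow_mem_closure_commutator (t : ZH) :
    cPow t ∈ (⁅(⊤ : Subgroup F₂hatT), (⊤ : Subgroup F₂hatT)⁆).topologicalClosure :=
  apply_mem_closure_commutator_of_cPowSpec cPow cPow_spec t

/-- **`c^· : Ẑ → F̂₂` is injective** (the `z`-coordinates `t mod N` of `ĥ_N(c^t)` determine `t`).
[cite: MochizukiEtTh2009, §1 p.12] -/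
theorem cPow_injective : Injective cPow := fun t t' h => by
  refine ext_of_modN fun N => ?_
  have hz := congrArg Heis.z (congrArg (hHat N) h)
  rw [hHat_cPow, hHat_cPow] at hz
  exact Multiplicative.toAdd.injective hz

/-- `c^·` is a closed embedding (continuous injective, compact source, Hausdorff target).
[cite: MochizukiEtTh2009, §1 p.12] -/
theorem isClosedEmbedding_cPow : _root_.Topology.IsClosedEmbedding cPow :=
  cPow.continuous.isClosedEmbedding cPow_injective

/-- **The commutator axis `c^Ẑ ⊆ F̂₂`**, the range of `c^·`. [cite: MochizukiEtTh2009, Def 2.1 p.35] -/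
def cAxis : Subgroup F₂hatT := cPow.toMonoidHom.range

/-- [cite: MochizukiEtTh2009, §1 p.12] -/
theorem mem_cAxis_iff (x : F₂hatT) : x ∈ cAxis ↔ ∃ t, cPow t = x := Iff.rfl

/-- [cite: MochizukiEtTh2009, §1 p.12] -/
theorem cPow_mem_cAxis (t : ZH) : cPow t ∈ cAxis := ⟨t, rfl⟩

/-- `η(c) ∈ c^Ẑ`. [cite: MochizukiEtTh2009, §1 p.12] -/
theorem eta_cElt_mem_cAxis : eta cElt ∈ cAxis := ⟨_, cPow_spec⟩

/-- `c^Ẑ` is closed in `F̂₂`. [cite: MochizukiSemiAnbd2006, §6 p.71] -/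
theorem isClosed_cAxis : IsClosed (cAxis : Set F₂hatT) := by
  change IsClosed (Set.range cPow.toMonoidHom)
  exact isClosedEmbedding_cPow.isClosed_range

/-- **`c^Ẑ = ⟨η⁅a,b⁆⟩⁻`**: the range of `c^·` is the closure of the cyclic group on `η(c)` (`ι(ℤ)` is dense in
`Ẑ` and `c^·` is continuous with closed range). [cite: MochizukiEtTh2009, Def 2.1 p.35] -/
theorem cAxis_eq_closure_zpowers : cAxis = (Subgroup.zpowers (eta cElt)).topologicalClosure := by
  refine le_antisymm ?_ (Subgroup.topologicalClosure_minimal _ ?_ isClosed_cAxis)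
  · -- `cPow(Ẑ) = cPow(closure ι(ℤ)) ⊆ closure cPow(ι(ℤ)) = closure ⟨η c⟩`
    rintro _ ⟨t, rfl⟩
    have hdense : DenseRange iotaZ :=
      ProfiniteGrp.ProfiniteCompletion.denseRange (G := GrpCat.of (Multiplicative ℤ))
    have ht : t ∈ closure (Set.range iotaZ) := hdense.closure_range ▸ Set.mem_univ t
    have himg : cPow t ∈ closure (cPow '' Set.range iotaZ) :=
      image_closure_subset_closure_image cPow.continuous ⟨t, ht, rfl⟩
    change cPow t ∈ closure ((Subgroup.zpowers (eta cElt) : Subgroup F₂hatT) : Set F₂hatT)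
    refine closure_mono ?_ himg
    rintro _ ⟨_, ⟨k, rfl⟩, rfl⟩
    change cPow (iotaZ k) ∈ (Subgroup.zpowers (eta cElt) : Set F₂hatT)
    rw [cPow_iotaZ, map_zpow]
    exact Subgroup.zpow_mem_zpowers _ _
  · rw [Subgroup.zpowers_le]
    exact eta_cElt_mem_cAxis

/-- **`Ẑ ≃ₜ* c^Ẑ`** (`c^·` corestricted to its range; a homeomorphism by the closed-embedding property).
[cite: MochizukiSemiAnbd2006, §6 p.71] -/
def zHatEquivCAxis : ZH ≃ₜ* cAxis :=
  let E : ZH ≃ cAxis :=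
    { toFun := fun t => ⟨cPow t, cPow_mem_cAxis t⟩
      invFun := fun x => Classical.choose x.2
      left_inv := fun t => cPow_injective (Classical.choose_spec (cPow_mem_cAxis t))
      right_inv := fun x => Subtype.ext (Classical.choose_spec x.2) }
  have hE : Continuous E := cPow.continuous.subtype_mk _
  { E with
    map_mul' := fun u v => Subtype.ext (map_mul cPow u v)
    continuous_toFun := hE
    continuous_invFun := Continuous.continuous_symm_of_equiv_compact_to_t2 hE }

/-- [cite: MochizukiEtTh2009, §1 p.12] -/
@[simp] theorem zHatEquivCAxis_apply_coe (t : ZH) : ((zHatEquivCAxis t : cAxis) : F₂hatT) = cPow t := rfl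

/-- **`c^Ẑ ≃ₜ* Ẑ`** — the shape of the clause `inertia_equiv_zHat` («`I_x ≅ Ẑ(1)`»). [cite: MochizukiSemiAnbd2006, §6 p.71] -/
def cAxisEquiv : cAxis ≃ₜ* ZHat := zHatEquivCAxis.symm

/-! ## §2. The commutator axis inside `Γ = F̂₂ ×_Ẑ ℤ` and the cusp datum on `Π^tp_X = Γ × G_{ℚ_p}` -/

/-- `(c^t, 0) ∈ Γ` (`ê(c^t) = 1 = ι 0`). [cite: MochizukiEtTh2009, §1 p.12] -/
theorem cPow_one_mem_Gfp (t : ZH) : ((cPow t, 1) : F₂hatT × Multiplicative ℤ) ∈ Gfp := by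
  rw [mem_Gfp, eHat_cPow, map_one]

/-- **`c^· : Ẑ → Γ`**, `t ↦ (c^t, 0)`. [cite: MochizukiEtTh2009, §1 p.12] -/
def cPowGfp : ZH →ₜ* Gfp where
  toFun t := ⟨(cPow t, 1), cPow_one_mem_Gfp t⟩
  map_one' := Subtype.ext (Prod.ext (map_one cPow) rfl)
  map_mul' s t := Subtype.ext (Prod.ext (map_mul cPow s t) (mul_one _).symm)
  continuous_toFun := (cPow.continuous.prodMk continuous_const).subtype_mk _

/-- [cite: MochizukiEtTh2009, §1 p.12] -/
@[simp] theorem gfpFst_cPowGfp (t : ZH) : gfpFst (cPowGfp t) = cPow t := rfl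

/-- [cite: MochizukiEtTh2009, §1 p.12] -/
@[simp] theorem gfpSnd_cPowGfp (t : ZH) : gfpSnd (cPowGfp t) = 1 := rfl

/-- [cite: MochizukiEtTh2009, §1 p.12] -/
theorem coe_cPowGfp (t : ZH) : ((cPowGfp t : Gfp) : F₂hatT × Multiplicative ℤ) = (cPow t, 1) := rfl

/-- `c^· : Ẑ → Γ` is injective. [cite: MochizukiEtTh2009, §1 p.12] -/
theorem cPowGfp_injective : Injective cPowGfp := fun _ _ h =>
  cPow_injective (congrArg (fun q : Gfp => (q : F₂hatT × Multiplicative ℤ).1) h)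

/-- `c^· : Ẑ → Γ` is a closed embedding. [cite: MochizukiEtTh2009, §1 p.12] -/
theorem isClosedEmbedding_cPowGfp : _root_.Topology.IsClosedEmbedding cPowGfp :=
  cPowGfp.continuous.isClosedEmbedding cPowGfp_injective

/-- **The commutator axis `c^Ẑ ⊆ Γ`.** [cite: MochizukiEtTh2009, Def 2.1 p.35] -/
def cAxisGfp : Subgroup Gfp := cPowGfp.toMonoidHom.range

/-- [cite: MochizukiEtTh2009, §1 p.12] -/
theorem mem_cAxisGfp_iff (q : Gfp) : q ∈ cAxisGfp ↔ ∃ t, cPowGfp t = q := Iff.rfl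

/-- [cite: MochizukiEtTh2009, §1 p.12] -/
theorem cPowGfp_mem_cAxisGfp (t : ZH) : cPowGfp t ∈ cAxisGfp := ⟨t, rfl⟩

/-- `c^Ẑ` is closed in `Γ`. [cite: MochizukiSemiAnbd2006, §6 p.71] -/
theorem isClosed_cAxisGfp : IsClosed (cAxisGfp : Set Gfp) := by
  change IsClosed (Set.range cPowGfp.toMonoidHom)
  exact isClosedEmbedding_cPowGfp.isClosed_range

/-- The axis lies in `Ker(Γ ↠ ℤ)` (the `Π^tp_Y` direction: clause (P3) «`D_x ≤ Π^tp_Y`»). [cite: MochizukiEtTh2009, §1 p.13] -/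
theorem cAxisGfp_le_ker_gfpSnd : cAxisGfp ≤ gfpSnd.ker := by
  rintro _ ⟨t, rfl⟩
  exact gfpSnd_cPowGfp t

/-- `pr₁(c^Ẑ ⊆ Γ) = c^Ẑ ⊆ F̂₂`. [cite: MochizukiEtTh2009, §1 p.12] -/
theorem map_gfpFst_cAxisGfp : cAxisGfp.map gfpFst.toMonoidHom = cAxis := by
  ext x
  constructor
  · rintro ⟨_, ⟨t, rfl⟩, rfl⟩
    exact cPow_mem_cAxis t
  · rintro ⟨t, rfl⟩
    exact ⟨cPowGfp t, cPowGfp_mem_cAxisGfp t, rfl⟩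

/-- **`Ẑ ≃ₜ* (c^Ẑ ⊆ Γ)`.** [cite: MochizukiSemiAnbd2006, §6 p.71] -/
def zHatEquivCAxisGfp : ZH ≃ₜ* cAxisGfp :=
  let E : ZH ≃ cAxisGfp :=
    { toFun := fun t => ⟨cPowGfp t, cPowGfp_mem_cAxisGfp t⟩
      invFun := fun x => Classical.choose x.2
      left_inv := fun t => cPowGfp_injective (Classical.choose_spec (cPowGfp_mem_cAxisGfp t))
      right_inv := fun x => Subtype.ext (Classical.choose_spec x.2) }
  have hE : Continuous E := cPowGfp.continuous.subtype_mk _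
  { E with
    map_mul' := fun u v => Subtype.ext (map_mul cPowGfp u v)
    continuous_toFun := hE
    continuous_invFun := Continuous.continuous_symm_of_equiv_compact_to_t2 hE }

/-- **`(c^Ẑ ⊆ Γ) ≃ₜ* Ẑ`.** [cite: MochizukiSemiAnbd2006, §6 p.71] -/
def cAxisGfpEquiv : cAxisGfp ≃ₜ* ZHat := zHatEquivCAxisGfp.symm

variable (p : ℕ) [Fact p.Prime]

/-- **The cusp datum `D_x := c^Ẑ × G_{ℚ_p} ⊆ Π^tp_X = Γ × G_{ℚ_p}`** of the finer (untwisted) model: the arithmetic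
factor acts trivially on `Γ`, so the commutator axis times the whole Galois factor is a (closed) subgroup.
[cite: MochizukiEtTh2009, §1 p.13] -/
def cuspDecomp₂c : Subgroup (PiTp₂ p) := cAxisGfp.prod ⊤

/-- [cite: MochizukiEtTh2009, §1 p.13] -/
theorem mem_cuspDecomp₂c_iff (g : PiTp₂ p) : g ∈ cuspDecomp₂c p ↔ g.1 ∈ cAxisGfp := by
  simp [cuspDecomp₂c, Subgroup.mem_prod]

/-- `D_x` is closed. [cite: MochizukiSemiAnbd2006, §6 p.71] -/
theorem isClosed_cuspDecomp₂c : IsClosed (cuspDecomp₂c p : Set (PiTp₂ p)) := by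
  rw [cuspDecomp₂c, Subgroup.coe_prod]
  exact isClosed_cAxisGfp.prod isClosed_univ

/-- «`D_x` always surjects onto an open subgroup of `G_K`»: here onto ALL of `G_{ℚ_p}` (the cusp is rational).
[cite: MochizukiSemiAnbd2006, §6 p.71] -/
theorem image_aug_cuspDecomp₂c : (augM₂ p) '' (cuspDecomp₂c p : Set (PiTp₂ p)) = Set.univ := by
  refine Set.eq_univ_of_forall fun σ => ⟨((1 : Gfp), (σ : Gam p)), ?_, rfl⟩
  exact (mem_cuspDecomp₂c_iff p _).mpr (one_mem _)

/-- [cite: MochizukiSemiAnbd2006, §6 p.71] -/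
theorem isOpen_image_aug_cuspDecomp₂c : IsOpen ((augM₂ p) '' (cuspDecomp₂c p : Set (PiTp₂ p))) := by
  rw [image_aug_cuspDecomp₂c]; exact isOpen_univ

/-- **The inertia subgroup `I_x = D_x ∩ Δ^tp_X = c^Ẑ × 1`.** [cite: MochizukiSemiAnbd2006, §6 p.71] -/
theorem cuspDecomp₂c_inf_ker_aug :
    cuspDecomp₂c p ⊓ (augM₂ p).toMonoidHom.ker = cAxisGfp.prod ⊥ := by
  ext ⟨γ, σ⟩
  simp only [Subgroup.mem_inf, mem_cuspDecomp₂c_iff, MonoidHom.mem_ker, Subgroup.mem_prod, Subgroup.mem_bot]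
  exact Iff.rfl

/-- **`I_x ≃ₜ* Ẑ`** («`I_x` is isomorphic to `Ẑ(1)` if `x` is a cusp»). [cite: MochizukiSemiAnbd2006, §6 p.71] -/
def inertiaEquiv₂c : ↥(cuspDecomp₂c p ⊓ (augM₂ p).toMonoidHom.ker) ≃ₜ* ZHat :=
  ContinuousMulEquiv.trans
    ({ toFun := fun g => ⟨(g.1).1, ((mem_cuspDecomp₂c_iff p _).mp (Subgroup.mem_inf.mp g.2).1)⟩
       invFun := fun q => ⟨((q : Gfp), 1), Subgroup.mem_inf.mpr ⟨(mem_cuspDecomp₂c_iff p _).mpr q.2, rfl⟩⟩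
       left_inv := fun g => by
         obtain ⟨⟨γ, σ⟩, hg⟩ := g
         have hσ : σ = 1 := (Subgroup.mem_inf.mp hg).2
         subst hσ
         rfl
       right_inv := fun _ => rfl
       map_mul' := fun _ _ => rfl
       continuous_toFun := (continuous_fst.comp continuous_subtype_val).subtype_mk _
       continuous_invFun := (continuous_subtype_val.prodMk continuous_const).subtype_mk _ } :
      ↥(cuspDecomp₂c p ⊓ (augM₂ p).toMonoidHom.ker) ≃ₜ* cAxisGfp)
    cAxisGfpEquiv

/-! ## §3. `curve₂ᶜ` and `ThetaSetting.model₂ᶜ` -/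

/-- **`curve₂ᶜ p : TemperedCurve p`** — abc-iut-L2-t1's `curve₂ p` (`K := ℚ_p`, `Π^tp := Γ × G_{ℚ_p}`,
`Π := F̂₂ × Ĝ_{ℚ_p}`) with ONE closed point, a cusp, whose decomposition group is `c^Ẑ × G_{ℚ_p}`.
[cite: MochizukiEtTh2009, §1 p.11] -/
abbrev curve₂c : TemperedCurve p :=
  { curve₂ p with
    Pt := Unit
    IsCusp := fun _ => True
    decomp := fun _ => cuspDecomp₂c p
    isClosed_decomp := fun _ => isClosed_cuspDecomp₂c p
    isOpen_aug_decomp := fun _ => isOpen_image_aug_cuspDecomp₂c p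
    inertia_eq_bot := fun _ h => (h trivial).elim
    inertia_equiv_zHat := fun _ _ => ⟨inertiaEquiv₂c p⟩ }

/-- `curve₂ᶜ` has the same tempered group as `curve₂`. [cite: MochizukiEtTh2009, §1 p.12] -/
theorem curve₂c_piTemp : (curve₂c p).PiTemp = PiTp₂ p := rfl

/-- `curve₂ᶜ` has the same augmentation as `curve₂`. [cite: MochizukiEtTh2009, §1 p.12] -/
theorem curve₂c_aug : (curve₂c p).aug = augM₂ p := rfl

/-- `curve₂ᶜ` has the same completion map as `curve₂`. [cite: MochizukiEtTh2009, §1 p.12] -/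
theorem curve₂c_toHat : (curve₂c p).toHat = toHat₂ p := rfl

/-- `Δ^tp` agrees. [cite: MochizukiEtTh2009, §1 p.12] -/
theorem curve₂c_deltaTemp : (curve₂c p).DeltaTemp = (curve₂ p).DeltaTemp := rfl

/-- `Δ_X` agrees. [cite: MochizukiEtTh2009, §1 p.12] -/
theorem curve₂c_deltaHat : (curve₂c p).DeltaHat = (curve₂ p).DeltaHat := rfl

/-- Every point of `curve₂ᶜ` is a cusp. [cite: MochizukiEtTh2009, §1 p.12] -/
theorem isCusp_curve₂c (x : (curve₂c p).Pt) : (curve₂c p).IsCusp x := trivial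

/-- The decomposition group of the cusp. [cite: MochizukiEtTh2009, §1 p.13] -/
theorem decomp_curve₂c (x : (curve₂c p).Pt) : (curve₂c p).decomp x = cuspDecomp₂c p := rfl

/-- **`I_x = c^Ẑ × 1`** for the cusp of `curve₂ᶜ`. [cite: MochizukiSemiAnbd2006, §6 p.71] -/
theorem inertia_curve₂c_eq (x : (curve₂c p).Pt) : (curve₂c p).inertia x = cAxisGfp.prod ⊥ :=
  cuspDecomp₂c_inf_ker_aug p

/-- `Δ_X` of `curve₂ᶜ` is profinite free on two generators. [cite: MochizukiEtTh2009, §1 p.12] -/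
theorem isFreeProfiniteOnTwo_deltaHat_curve₂c : IsFreeProfiniteOnTwo (curve₂c p).DeltaHat :=
  isFreeProfiniteOnTwo_deltaHat₂ p

/-- **`ThetaSetting.model₂ᶜ p : ThetaSetting p`** — abc-iut-L2-t1's finer root model `model₂` VERBATIM over the
cusped carrier `curve₂ᶜ` (all carriers, quotients and coverings agree definitionally). [cite: MochizukiEtTh2009, §1 p.11] -/
abbrev _root_.Literature.AnabelianGeometry.EtaleTheta.ThetaSetting.model₂c : ThetaSetting p :=
  { ThetaSetting.model₂ p with toTemperedCurve := curve₂c p }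

/-- **The cusped finer model satisfies the guard `IsEtThOrigin`.** [cite: MochizukiEtTh2009, §1 p.12] -/
theorem _root_.Literature.AnabelianGeometry.EtaleTheta.ThetaSetting.model₂c_isEtThOrigin :
    (ThetaSetting.model₂c p).IsEtThOrigin :=
  ThetaSetting.IsEtThOrigin.of_free (isFreeProfiniteOnTwo_deltaHat_curve₂c p)

/-- `model₂ᶜ` has a cusp. [cite: MochizukiEtTh2009, §1 p.12] -/
theorem exists_isCusp_model₂c : ∃ x : (ThetaSetting.model₂c p).Pt, (ThetaSetting.model₂c p).IsCusp x :=
  ⟨(), trivial⟩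

/-- **`I_x = c^Ẑ × 1`** at `model₂ᶜ`. [cite: MochizukiSemiAnbd2006, §6 p.71] -/
theorem inertia_model₂c_eq (x : (ThetaSetting.model₂c p).Pt) :
    (ThetaSetting.model₂c p).inertia x = cAxisGfp.prod ⊥ :=
  cuspDecomp₂c_inf_ker_aug p

/-- (P3) «decomposition groups of cusps lie in `Π^tp_Y = Ker(Π^tp_X ↠ Z)`» at `model₂ᶜ` (the commutator axis has
`a`-degree `0`). [cite: MochizukiEtTh2009, §1 p.13] -/
theorem decomp_model₂c_le_ker_toZ (x : (ThetaSetting.model₂c p).Pt) :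
    (ThetaSetting.model₂c p).decomp x ≤ (ThetaSetting.model₂c p).toZ.ker := fun g hg => by
  rw [MonoidHom.mem_ker]
  change gfpSnd g.1 = 1
  exact cAxisGfp_le_ker_gfpSnd ((mem_cuspDecomp₂c_iff p g).mp hg)

/-! ### The commutator-axis clause ON THE NOSE at `model₂ᶜ` -/

/-- The generator `a = (η a, 1) ∈ Δ_X = F̂₂ × 1`. [cite: MochizukiEtTh2009, §1 p.12] -/
def genA₂c : (ThetaSetting.model₂c p).DeltaHat := ⟨(eta (FreeGroup.of 0), 1), mk_one_mem_deltaHat₂ p _⟩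

/-- The generator `b = (η b, 1) ∈ Δ_X = F̂₂ × 1`. [cite: MochizukiEtTh2009, §1 p.12] -/
def genB₂c : (ThetaSetting.model₂c p).DeltaHat := ⟨(eta (FreeGroup.of 1), 1), mk_one_mem_deltaHat₂ p _⟩

/-- `⁅a, b⁆ = (η c, 1)` in `Π_X`. [cite: MochizukiEtTh2009, §1 p.12] -/
theorem commutator_genA₂c_genB₂c :
    ⁅((genA₂c p : (ThetaSetting.model₂c p).DeltaHat) : PiHt p), ((genB₂c p : (ThetaSetting.model₂c p).DeltaHat) : PiHt p)⁆ =
      ((eta cElt, 1) : PiHt p) := by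
  change ⁅((eta (FreeGroup.of 0), 1) : PiHt p), ((eta (FreeGroup.of 1), 1) : PiHt p)⁆ = _
  rw [commutatorElement_def]
  refine Prod.ext ?_ ?_
  · change eta (FreeGroup.of 0) * eta (FreeGroup.of 1) * (eta (FreeGroup.of 0))⁻¹ * (eta (FreeGroup.of 1))⁻¹ =
      eta cElt
    rw [cElt, commutatorElement_def, map_mul, map_mul, map_mul, map_inv, map_inv]
  · change (1 : GamHatT p) * 1 * 1⁻¹ * 1⁻¹ = 1
    simp

/-- **`a, b` topologically generate `Δ_X`** (`η(F₂)` is dense in `F̂₂` and `F₂ = ⟨a, b⟩`).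
[cite: MochizukiEtTh2009, §1 p.12] -/
theorem closure_genA₂c_genB₂c :
    (Subgroup.closure ({genA₂c p, genB₂c p} : Set (ThetaSetting.model₂c p).DeltaHat)).topologicalClosure = ⊤ := by
  -- transport along `deltaHat₂Equiv : F̂₂ ≃ₜ* Δ_X`
  let e : F₂hatT ≃ₜ* (ThetaSetting.model₂c p).DeltaHat := deltaHat₂Equiv p
  have hA : e (eta (FreeGroup.of 0)) = genA₂c p := rfl
  have hB : e (eta (FreeGroup.of 1)) = genB₂c p := rfl
  set H : Subgroup F₂hatT := Subgroup.closure ({eta (FreeGroup.of (0 : Fin 2)), eta (FreeGroup.of 1)} : Set F₂hatT)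
    with hH
  rw [eq_top_iff]
  rintro y -
  obtain ⟨x, rfl⟩ := e.surjective y
  -- `F₂ = ⟨a, b⟩`, so `η(F₂) ⊆ H` and `x ∈ closure η(F₂) ⊆ closure H`
  have hF : Subgroup.closure ({FreeGroup.of (0 : Fin 2), FreeGroup.of 1} : Set F₂) = ⊤ := by
    rw [eq_top_iff, ← FreeGroup.closure_range_of, Subgroup.closure_le]
    rintro _ ⟨i, rfl⟩
    fin_cases i
    · exact Subgroup.subset_closure (Set.mem_insert _ _)
    · exact Subgroup.subset_closure (Set.mem_insert_of_mem _ (Set.mem_singleton _))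
  have hsub : Set.range eta ⊆ (H : Set F₂hatT) := by
    rintro _ ⟨g, rfl⟩
    have hg : g ∈ Subgroup.closure ({FreeGroup.of (0 : Fin 2), FreeGroup.of 1} : Set F₂) := hF ▸ trivial
    have := Subgroup.mem_map_of_mem eta hg
    rwa [MonoidHom.map_closure, Set.image_pair] at this
  have hx : x ∈ closure (H : Set F₂hatT) := closure_mono hsub (denseRange_eta x)
  -- push through `e`
  have key : e x ∈ closure (e '' (H : Set F₂hatT)) := image_closure_subset_closure_image e.continuous ⟨x, hx, rfl⟩
  have himg : e '' (H : Set F₂hatT) =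
      ((Subgroup.closure ({genA₂c p, genB₂c p} : Set (ThetaSetting.model₂c p).DeltaHat) : Subgroup _) : Set _) := by
    have h1 : e '' (H : Set F₂hatT) = ((H.map e.toMulEquiv.toMonoidHom : Subgroup _) : Set _) := by
      rw [Subgroup.coe_map]; rfl
    rw [h1, hH, MonoidHom.map_closure, Set.image_pair]
    rfl
  rw [himg, ← Subgroup.topologicalClosure_coe] at key
  exact key

/-- **The commutator-axis clause at `model₂ᶜ`**: `toHat(I_x) = ⟨⁅a,b⁆⟩⁻` — the inertia of the cusp IS the closed
procyclic subgroup on the boundary commutator of the generating pair `a, b` of `Δ_X`.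
[cite: MochizukiEtTh2009, Def 2.1 p.35] -/
theorem map_toHat_inertia_model₂c (x : (ThetaSetting.model₂c p).Pt) :
    ((ThetaSetting.model₂c p).inertia x).map (ThetaSetting.model₂c p).toHat.toMonoidHom =
      (Subgroup.zpowers (⁅((genA₂c p : (ThetaSetting.model₂c p).DeltaHat) : (ThetaSetting.model₂c p).PiHat),
        ((genB₂c p : (ThetaSetting.model₂c p).DeltaHat) : (ThetaSetting.model₂c p).PiHat)⁆)).topologicalClosure := by
  rw [inertia_model₂c_eq, commutator_genA₂c_genB₂c]
  change (cAxisGfp.prod (⊥ : Subgroup (Gam p))).map (toHat₂ p).toMonoidHom =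
    (Subgroup.zpowers ((eta cElt, 1) : PiHt p)).topologicalClosure
  -- both sides equal `c^Ẑ × 1`
  have hL : (cAxisGfp.prod (⊥ : Subgroup (Gam p))).map (toHat₂ p).toMonoidHom =
      cAxis.prod (⊥ : Subgroup (GamHatT p)) := by
    ext ⟨u, v⟩
    simp only [Subgroup.mem_map, Subgroup.mem_prod, Subgroup.mem_bot, Prod.exists]
    constructor
    · rintro ⟨γ, σ, ⟨hγ, hσ⟩, h⟩
      rw [hσ] at h
      have h' : ((γ : F₂hatT × Multiplicative ℤ).1, etaGam p 1) = (u, v) := h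
      rw [map_one, Prod.mk.injEq] at h'
      obtain ⟨rfl, rfl⟩ := h'
      exact ⟨(map_gfpFst_cAxisGfp ▸ ⟨γ, hγ, rfl⟩ : gfpFst.toMonoidHom γ ∈ cAxis), rfl⟩
    · rintro ⟨hu, rfl⟩
      obtain ⟨t, rfl⟩ := hu
      refine ⟨cPowGfp t, 1, ⟨cPowGfp_mem_cAxisGfp t, rfl⟩, ?_⟩
      change ((cPow t, etaGam p 1) : PiHt p) = (cPow t, 1)
      rw [map_one]
  have hR : (Subgroup.zpowers ((eta cElt, 1) : PiHt p)).topologicalClosure =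
      cAxis.prod (⊥ : Subgroup (GamHatT p)) := by
    have hz : Subgroup.zpowers ((eta cElt, 1) : PiHt p) =
        (Subgroup.zpowers (eta cElt)).prod (⊥ : Subgroup (GamHatT p)) := by
      ext ⟨u, v⟩
      simp only [Subgroup.mem_zpowers_iff, Subgroup.mem_prod, Subgroup.mem_bot, Prod.pow_mk, one_zpow,
        Prod.mk.injEq]
      constructor
      · rintro ⟨k, hk, rfl⟩; exact ⟨⟨k, hk⟩, rfl⟩
      · rintro ⟨⟨k, hk⟩, rfl⟩; exact ⟨k, hk, rfl⟩
    apply SetLike.coe_injective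
    rw [Subgroup.topologicalClosure_coe, hz, Subgroup.coe_prod, Subgroup.coe_prod, closure_prod_eq,
      ← Subgroup.topologicalClosure_coe, ← cAxis_eq_closure_zpowers, Subgroup.coe_bot, closure_singleton]
  rw [hL, hR]

/-! ## §4. Non-vacuity of the commutator-axis clause (jointly with the root interface and its guard) -/

/-- **At `model₂ᶜ` the cusp-position binder HOLDS: `toTheta(I_x) = Δ_Θ`** («`D_x → Π^Θ_X` maps the inertia group
`I_x` … onto `Δ_Θ`», p. 35) — by this seat's `ThetaSetting.map_toTheta_inertia_eq_deltaTheta_of_commutatorAxis`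
(p435890) from §3. [cite: MochizukiEtTh2009, Def 2.1 p.35] -/
theorem map_toTheta_inertia_model₂c (x : (ThetaSetting.model₂c p).Pt) :
    ((ThetaSetting.model₂c p).inertia x).map (ThetaSetting.model₂c p).toTheta = (ThetaSetting.model₂c p).DeltaTheta :=
  (ThetaSetting.model₂c p).map_toTheta_inertia_eq_deltaTheta_of_commutatorAxis x (closure_genA₂c_genB₂c p)
    (map_toHat_inertia_model₂c p x)

/-- **NON-VACUITY of the commutator-axis clause**: there is a `ThetaSetting p` satisfying the guard `IsEtThOrigin`
WITH a cusp `x` whose inertia lies on the commutator axis — `toHat(I_x) = ⟨⁅a,b⁆⟩⁻` for a topological generating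
pair `a, b` of `Δ_X` (the v-next §1 interface clause of record, GAP-LEDGER l.273) — and for which, consequently,
`toTheta(I_x) = Δ_Θ` (the binder family of GAP-LEDGER G-L2t10-3 / p434999). SEMI-SYNTHETIC witness (`model₂ᶜ`):
consistency evidence only. [cite: MochizukiEtTh2009, Def 2.1 p.35] -/
theorem _root_.Literature.AnabelianGeometry.EtaleTheta.ThetaSetting.exists_isEtThOrigin_commutatorAxis_cusp :
    ∃ D : ThetaSetting p, D.IsEtThOrigin ∧ ∃ x : D.Pt, D.IsCusp x ∧ IsClosed (D.decomp x : Set D.PiTemp) ∧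
      ∃ a b : D.DeltaHat, (Subgroup.closure ({a, b} : Set D.DeltaHat)).topologicalClosure = ⊤ ∧
        (D.inertia x).map D.toHat.toMonoidHom =
          (Subgroup.zpowers (⁅(a : D.PiHat), (b : D.PiHat)⁆)).topologicalClosure ∧
        (D.inertia x).map D.toTheta = D.DeltaTheta :=
  ⟨ThetaSetting.model₂c p, ThetaSetting.model₂c_isEtThOrigin p, (), trivial, isClosed_cuspDecomp₂c p,
    genA₂c p, genB₂c p, closure_genA₂c_genB₂c p, map_toHat_inertia_model₂c p (), map_toTheta_inertia_model₂c p ()⟩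

end Literature.AnabelianGeometry.EtaleTheta.SettingModel

end
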